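import Mathlib
import Summits.CriticalPhenomena.CardyFormulaZ2.Theorems.CardyMagicRigidityHexSegmentDefs
import Summits.CriticalPhenomena.CardyFormulaZ2.Theorems.CardyMagicRigidityLoopLimitZ2EqTSiteEndCrossingsPort
import Summits.CriticalPhenomena.CardyFormulaZ2.Theorems.CardyMagicRigidityLoopLimitZ2EqTSiteEndCrossingsCorners
import Literature.Probability.Percolation.CardyFormula
import Literature.Probability.Percolation.SharpnessDCTProofs
import Literature.Probability.Percolation.SitePaths
import HarnessLib

/-!
# Stub `stub_siteEndCrossings` (S7a), line `Sketch`, crux `LoopLimitZ2EqT` (stmt-CriticalPhenomena-4833):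
# the up-cell dictionary and the two deterministic sandwich inclusions

Helper file (`--supports stmt-CriticalPhenomena-4833`). At `t = 0` the bond configuration of the
segment model is a.s. the **all-or-nothing** configuration `A σ = {upEdge x k | x ∈ σ}` of the
fair-coin layer `σ` (`siteEnd_ae_cfg`). We prove the dictionary between open bond paths of `A σ` and
`𝕋`-paths of open cells (two up-cells share a corner iff their anchors are equal or `𝕋`-adjacent;
the corners of a cell are pairwise joined by its edges) and the two DETERMINISTIC inclusions of the
Bollobás–Riordan sandwich (*Percolation* (2006), Ch. 7, Lemma 14 p. 184, Claim 19 p. 192, remark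
p. 195) for the crude event `A σ ∈ embDomainCrossing triEmbed Ω δ (R.arc 0) (R.arc 2)`:
`siteEndCrossings_lower` (an open `𝕋`-crossing of a LOWER comparison rectangle `Q` forces a crude
crossing of `R`: port the chain of corners of its cells, `siteEndCrossings_port`) and
`siteEndCrossings_upper` (a crude crossing of `R` forces an open `𝕋`-crossing of an UPPER comparison
rectangle `D`: port the chain of cells of its edges).
-/

noncomputable section

open Set Metric

namespace Summit.CriticalPhenomena.CardyFormulaZ2.Cruxes.LoopLimitZ2EqT.HexSegment

open Literature.Probability.Percolation Literature.Probability.LatticeModels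
  Literature.Probability.RandomPlanarGeometry

/-! ### The lower inclusion: a crossing of the lower comparison rectangle is a crude crossing -/

/-- **Lower sandwich inclusion.** Let `Q` be in lower sandwich position w.r.t. `R = (Ω; …)` with
room `r`, plate margin `t` and lateral margin `m` (`2t + 2δ < dist(R.arc 0, R.arc 2)`, `δ < r`,
`δ < m`). Then for every cell set `σ`, an open `𝕋`-path of `σ` with all sites in `Q` from a site
`δ`-close to `Q.arc 0` to a site `δ`-close to `Q.arc 2` forces a crude crossing of `R` by the
all-or-nothing configuration of `σ`: the chain of corners of its cells (consecutive corners equal or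
joined by an open edge) is ported by `siteEndCrossings_port`.
(Bollobás–Riordan, *Percolation* (2006), Ch. 7, Claim 19 p. 192.) -/
theorem siteEndCrossings_lower : ∀ (R Q : ConformalRectangle) {t m r δ d : ℝ},
    (∀ z ∈ cthickening r Q.carrier, z ∉ R.carrier → infDist z (R.arc 0) ≤ t ∨ infDist z (R.arc 2) ≤ t) →
    (∀ z ∈ cthickening r Q.carrier, z ∈ R.carrier → m ≤ infDist z (R.arc 1) ∧ m ≤ infDist z (R.arc 3)) →
    (∀ z ∈ cthickening r (Q.arc 0), z ∉ R.carrier ∧ infDist z (R.arc 0) ≤ t) →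
    (∀ z ∈ cthickening r (Q.arc 2), z ∉ R.carrier ∧ infDist z (R.arc 2) ≤ t) →
    (∀ a ∈ R.arc 0, ∀ b ∈ R.arc 2, d < dist a b) → 2 * t + 2 * δ < d → 0 < δ → δ < r → δ < m →
    ∀ {σ : SiteConfig (Site 2)} {u v : Site 2},
    infDist (triMeshPoint δ u) (Q.arc 0) ≤ 1 * δ → infDist (triMeshPoint δ v) (Q.arc 2) ≤ 1 * δ →
    σ ∈ siteConnIn triGraph (triMeshVertices Q.carrier δ) u v →
    ({e | ∃ (x : Site 2) (k : Fin 3), e = upEdge x k ∧ x ∈ σ} : BondConfig (Site 2)) ∈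
      embDomainCrossing triEmbed R.carrier δ (R.arc 0) (R.arc 2) := by
  intro R Q t m r δ d hL1 hL2 hL3 hL4 hd htd hδ hδr hδm σ u v hu hv hσ
  set ω : BondConfig (Site 2) := {e | ∃ (x : Site 2) (k : Fin 3), e = upEdge x k ∧ x ∈ σ} with hω
  have hP := mem_siteConnIn_iff_pathIn.1 hσ
  -- corners of open cells anchored in `Q`
  set Good : Site 2 → Prop := fun c => ∃ s : Site 2, s ∈ σ ∧ triMeshPoint δ s ∈ Q.carrier ∧
    ((c 0 = s 0 ∧ c 1 = s 1) ∨ (c 0 = s 0 + 1 ∧ c 1 = s 1) ∨ (c 0 = s 0 ∧ c 1 = s 1 + 1)) with hGood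
  set Rel : Site 2 → Site 2 → Prop := fun a b => a = b ∨ (openGraph ω).Adj a b with hRel
  -- two distinct corners of an open cell are joined by an open edge
  have hedge : ∀ {s a b : Site 2}, s ∈ σ →
      ((a 0 = s 0 ∧ a 1 = s 1) ∨ (a 0 = s 0 + 1 ∧ a 1 = s 1) ∨ (a 0 = s 0 ∧ a 1 = s 1 + 1)) →
      ((b 0 = s 0 ∧ b 1 = s 1) ∨ (b 0 = s 0 + 1 ∧ b 1 = s 1) ∨ (b 0 = s 0 ∧ b 1 = s 1 + 1)) → Rel a b := by
    intro s a b hs ha hb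
    by_cases hab : a = b
    · exact Or.inl hab
    · obtain ⟨k, hk⟩ := siteEndCrossings_upEdge_of_corners ha hb hab
      exact Or.inr ((openGraph_adj ω a b).2 ⟨⟨s, k, hk, hs⟩, hab⟩)
  -- the chain of corners
  have claim : ∀ s, Relation.ReflTransGen (fun a b => triGraph.Adj a b ∧ b ∈ triMeshVertices Q.carrier δ ∩ σ) u s →
      s ∈ triMeshVertices Q.carrier δ ∩ σ ∧ ∀ c : Site 2,
        ((c 0 = s 0 ∧ c 1 = s 1) ∨ (c 0 = s 0 + 1 ∧ c 1 = s 1) ∨ (c 0 = s 0 ∧ c 1 = s 1 + 1)) →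
        Relation.ReflTransGen (fun a b => Rel a b ∧ Good b) u c := by
    intro s h
    induction h with
    | refl =>
      refine ⟨hP.1, fun c hc => Relation.ReflTransGen.single ⟨hedge hP.1.2 (Or.inl ⟨rfl, rfl⟩) hc, ?_⟩⟩
      exact ⟨u, hP.1.2, hP.1.1, hc⟩
    | tail _ hab ih =>
      rename_i a b _
      obtain ⟨haS, iha⟩ := ih
      refine ⟨hab.2, fun c hc => ?_⟩
      obtain ⟨w, hwa, hwb⟩ := siteEndCrossings_exists_shared_corner hab.1
      exact (iha w hwa).tail ⟨hedge hab.2.2 hwb hc, b, hab.2.2, hab.2.1, hc⟩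
  have hchain : Relation.ReflTransGen (fun a b => Rel a b ∧ Good b) u v := (claim v hP.2).2 v (Or.inl ⟨rfl, rfl⟩)
  have hGu : Good u := ⟨u, hP.1.2, hP.1.1, Or.inl ⟨rfl, rfl⟩⟩
  -- good points lie in the `r`-fattening of `Q`
  have hfat : ∀ a, Good a → triMeshPoint δ a ∈ cthickening r Q.carrier := fun a ⟨s, _, hsQ, hc⟩ =>
    mem_cthickening_of_dist_le _ _ _ _ hsQ ((siteEndCrossings_dist_anchor_le hδ hc).trans hδr.le)
  -- the port
  have hcap : ∀ {w : Site 2} {E : Set ℂ}, E.Nonempty → infDist (triMeshPoint δ w) E ≤ 1 * δ →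
      triMeshPoint δ w ∈ cthickening r E := fun hE hw => by
    obtain ⟨y, hy, hwy⟩ := (infDist_lt_iff hE).1 (show infDist (triMeshPoint δ _) _ < r by linarith)
    exact mem_cthickening_of_dist_le _ y _ _ hy hwy.le
  obtain ⟨huΩ, huA⟩ := hL3 _ (hcap ⟨_, Q.pt_mem_arc_self 0⟩ hu)
  obtain ⟨hvΩ, hvB⟩ := hL4 _ (hcap ⟨_, Q.pt_mem_arc_self 2⟩ hv)
  obtain ⟨p, q, hGp, hpΩ, hpA, hrun, hqΩ, hqB⟩ := siteEndCrossings_port (Ω := R.carrier) (A := R.arc 0)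
    (B := R.arc 2) (C := R.arc 1 ∪ R.arc 3) R.carrier_ne_univ (siteEndCrossings_frontier_subset R).1
    ⟨_, R.pt_mem_arc_self 0⟩ ⟨_, R.pt_mem_arc_self 2⟩ hδ hd htd (Rel := Rel) (Good := Good)
    (fun a b hab => by
      rcases hab with rfl | hab
      · rw [dist_self]; exact hδ.le
      · obtain ⟨⟨s, k, hk, -⟩, hne⟩ := (openGraph_adj ω a b).1 hab
        obtain ⟨ha, hb⟩ := siteEndCrossings_corner_of_upEdge hk
        exact siteEndCrossings_dist_corner_le hδ ha hb)
    (fun a ha haΩ => hL1 _ (hfat a ha) haΩ)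
    (fun a ha haΩ q hq => by
      obtain ⟨h1, h3⟩ := hL2 _ (hfat a ha) haΩ
      rcases hq with hq | hq
      · have := infDist_le_dist_of_mem (x := triMeshPoint δ a) hq
        rw [dist_comm] at this; linarith
      · have := infDist_le_dist_of_mem (x := triMeshPoint δ a) hq
        rw [dist_comm] at this; linarith)
    hGu hchain huΩ huA hvΩ hvB
  -- the run is an open path of `A σ` through vertices drawn in `Ω`
  have hpath : ∀ w, Relation.ReflTransGen (fun a b => Rel a b ∧ Good b ∧ triMeshPoint δ b ∈ R.carrier) p w →
      PathIn (openGraph ω) {y : Site 2 | triMeshPoint δ y ∈ R.carrier} p w := by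
    intro w h
    induction h with
    | refl => exact PathIn.refl hpΩ
    | tail _ hbc ih =>
      rcases hbc.1 with rfl | hadj
      · exact ih
      · exact ih.tail hadj hbc.2.2
  rw [mem_embDomainCrossing_iff]
  exact ⟨p, hpA.trans (by linarith), q, hqB.trans (by linarith), DCT16.mem_openConnIn_iff_pathIn.2 (hpath q hrun)⟩

/-! ### The upper inclusion: a crude crossing is a crossing of the upper comparison rectangle -/

/-- **Upper sandwich inclusion.** Let `D` be in upper position w.r.t. `R = (Ω; …)`: every point of
`Ω` off `D` is `t`-close to `D.arc 0 ∪ D.arc 2`; the `r`-fattenings of `D.arc 1`, `D.arc 3` miss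
`Ω`; points of `Ω` in the `r`-fattening of `D` are `m`-far from `R.arc 0 ∪ R.arc 2`; the pairs
`(D.arc 2, D.arc 0)`, `(R.arc 0, D.arc 0)`, `(D.arc 2, R.arc 2)`, `(R.arc 0, R.arc 2)` are
`d`-separated; `δ ≤ t`, `2δ ≤ r`, `2δ < m`, `2t + 8δ < d`. Then every crude crossing of `R` by the
all-or-nothing configuration of a cell set `σ` yields an open `𝕋`-path of `σ` with sites in `D`
from a site `δ`-close to `D.arc 0` to a site `δ`-close to `D.arc 2`: the chain of (open) cells of its
edges, each with a corner in `Ω`, is ported by `siteEndCrossings_port` (from `D.arc 2` to `D.arc 0`)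
and reversed. (Bollobás–Riordan, *Percolation* (2006), Ch. 7, Claim 19 p. 192, remark p. 195.) -/
theorem siteEndCrossings_upper : ∀ (R D : ConformalRectangle) {t m r δ d : ℝ},
    (∀ z ∈ R.carrier, z ∉ D.carrier → infDist z (D.arc 2) ≤ t ∨ infDist z (D.arc 0) ≤ t) →
    (∀ z ∈ cthickening r (D.arc 1), z ∉ R.carrier) → (∀ z ∈ cthickening r (D.arc 3), z ∉ R.carrier) →
    (∀ z ∈ cthickening r D.carrier, z ∈ R.carrier → m ≤ infDist z (R.arc 0) ∧ m ≤ infDist z (R.arc 2)) →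
    (∀ a ∈ D.arc 2, ∀ b ∈ D.arc 0, d < dist a b) → (∀ a ∈ R.arc 0, ∀ b ∈ D.arc 0, d < dist a b) →
    (∀ a ∈ D.arc 2, ∀ b ∈ R.arc 2, d < dist a b) → (∀ a ∈ R.arc 0, ∀ b ∈ R.arc 2, d < dist a b) →
    0 < δ → δ ≤ t → 2 * δ ≤ r → 2 * δ < m → 2 * t + 8 * δ < d →
    ∀ {σ : SiteConfig (Site 2)},
    ({e | ∃ (x : Site 2) (k : Fin 3), e = upEdge x k ∧ x ∈ σ} : BondConfig (Site 2)) ∈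
      embDomainCrossing triEmbed R.carrier δ (R.arc 0) (R.arc 2) →
    ∃ u v : Site 2, infDist (triMeshPoint δ u) (D.arc 0) ≤ 1 * δ ∧ infDist (triMeshPoint δ v) (D.arc 2) ≤ 1 * δ ∧
      σ ∈ siteConnIn triGraph (triMeshVertices D.carrier δ) u v := by
  intro R D t m r δ d hV1 hV2 hV3 hV4 hd hd0 hd2 hdR hδ hδt hδr hδm htd σ hσ
  set ω : BondConfig (Site 2) := {e | ∃ (x : Site 2) (k : Fin 3), e = upEdge x k ∧ x ∈ σ} with hω
  rw [mem_embDomainCrossing_iff] at hσ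
  obtain ⟨u', hu', v', hv', hconn⟩ := hσ
  have hP : PathIn (openGraph ω) {y : Site 2 | triMeshPoint δ y ∈ R.carrier} u' v' :=
    DCT16.mem_openConnIn_iff_pathIn.1 hconn
  have hA0 : (R.arc 0).Nonempty := ⟨_, R.pt_mem_arc_self 0⟩
  have hA2 : (R.arc 2).Nonempty := ⟨_, R.pt_mem_arc_self 2⟩
  have hD0 : (D.arc 0).Nonempty := ⟨_, D.pt_mem_arc_self 0⟩
  have hD2 : (D.arc 2).Nonempty := ⟨_, D.pt_mem_arc_self 2⟩
  -- open cells with a corner in `Ω`, consecutive ones sharing a corner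
  set Good : Site 2 → Prop := fun x => x ∈ σ ∧ ∃ w : Site 2,
    ((w 0 = x 0 ∧ w 1 = x 1) ∨ (w 0 = x 0 + 1 ∧ w 1 = x 1) ∨ (w 0 = x 0 ∧ w 1 = x 1 + 1)) ∧
      triMeshPoint δ w ∈ R.carrier with hGood
  set Rel : Site 2 → Site 2 → Prop := fun x y => x = y ∨ triGraph.Adj x y with hRel
  have claim : ∀ b, Relation.ReflTransGen
      (fun a b => (openGraph ω).Adj a b ∧ b ∈ {y : Site 2 | triMeshPoint δ y ∈ R.carrier}) u' b →
      b = u' ∨ ∃ xf xl : Site 2, Good xf ∧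
        ((u' 0 = xf 0 ∧ u' 1 = xf 1) ∨ (u' 0 = xf 0 + 1 ∧ u' 1 = xf 1) ∨ (u' 0 = xf 0 ∧ u' 1 = xf 1 + 1)) ∧
        Relation.ReflTransGen (fun x y => Rel x y ∧ Good y) xf xl ∧
        ((b 0 = xl 0 ∧ b 1 = xl 1) ∨ (b 0 = xl 0 + 1 ∧ b 1 = xl 1) ∨ (b 0 = xl 0 ∧ b 1 = xl 1 + 1)) := by
    intro b h
    induction h with
    | refl => exact Or.inl rfl
    | tail _ hbc ih =>
      rename_i b c _
      obtain ⟨⟨x, k, hk, hxσ⟩, -⟩ := (openGraph_adj ω b c).1 hbc.1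
      obtain ⟨hbx, hcx⟩ := siteEndCrossings_corner_of_upEdge hk
      have hGx : Good x := ⟨hxσ, c, hcx, hbc.2⟩
      right
      rcases ih with rfl | ⟨xf, xl, hGf, hfu, hch, hlb⟩
      · exact ⟨x, x, hGx, hbx, Relation.ReflTransGen.refl, hcx⟩
      · exact ⟨xf, x, hGf, hfu, hch.tail ⟨siteEndCrossings_anchor_eq_or_adj hlb hbx, hGx⟩, hcx⟩
  -- the crossing is not trivial
  obtain ⟨xf, xl, hGf, hfu, hch, hlv⟩ : ∃ xf xl : Site 2, Good xf ∧
      ((u' 0 = xf 0 ∧ u' 1 = xf 1) ∨ (u' 0 = xf 0 + 1 ∧ u' 1 = xf 1) ∨ (u' 0 = xf 0 ∧ u' 1 = xf 1 + 1)) ∧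
      Relation.ReflTransGen (fun x y => Rel x y ∧ Good y) xf xl ∧
      ((v' 0 = xl 0 ∧ v' 1 = xl 1) ∨ (v' 0 = xl 0 + 1 ∧ v' 1 = xl 1) ∨ (v' 0 = xl 0 ∧ v' 1 = xl 1 + 1)) := by
    rcases claim v' hP.2 with rfl | h
    · have := siteEndCrossings_le_infDist_add hA0 hA2 hdR (triMeshPoint δ v') (triMeshPoint δ v')
      rw [dist_self] at this
      have h1 : infDist ((δ : ℂ) * triEmbed v') (R.arc 0) = infDist (triMeshPoint δ v') (R.arc 0) := rfl
      have h2 : infDist ((δ : ℂ) * triEmbed v') (R.arc 2) = infDist (triMeshPoint δ v') (R.arc 2) := rfl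
      rw [h1] at hu'; rw [h2] at hv'
      have ht : 0 ≤ t := hδ.le.trans hδt
      linarith
    · exact h
  have hu'' : infDist (triMeshPoint δ u') (R.arc 0) ≤ 2 * δ := hu'
  have hv'' : infDist (triMeshPoint δ v') (R.arc 2) ≤ 2 * δ := hv'
  have ht : 0 ≤ t := hδ.le.trans hδt
  -- kinds of good cells off `D`
  have hclass : ∀ a, Good a → triMeshPoint δ a ∉ D.carrier →
      infDist (triMeshPoint δ a) (D.arc 2) ≤ t + δ ∨ infDist (triMeshPoint δ a) (D.arc 0) ≤ t + δ := by
    rintro a ⟨-, w, hw, hwR⟩ haD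
    have hwa : dist (triMeshPoint δ w) (triMeshPoint δ a) ≤ δ := siteEndCrossings_dist_anchor_le hδ hw
    by_cases haR : triMeshPoint δ a ∈ R.carrier
    · rcases hV1 _ haR haD with h | h
      · exact Or.inl (by linarith)
      · exact Or.inr (by linarith)
    by_cases hwD : triMeshPoint δ w ∈ D.carrier
    · obtain ⟨y, hy, hyd⟩ := exists_mem_frontier_infDist_compl_eq_dist hwD D.carrier_ne_univ
      have hwy : dist (triMeshPoint δ w) y ≤ δ := by
        rw [← hyd]; exact (infDist_le_dist_of_mem (mem_compl haD)).trans hwa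
      have hay : dist (triMeshPoint δ a) y ≤ 2 * δ := by
        rw [dist_comm] at hwa; linarith [dist_triangle (triMeshPoint δ a) (triMeshPoint δ w) y]
      rcases (siteEndCrossings_frontier_subset D).2 hy with (hy2 | hy0) | (hy1 | hy3)
      · exact Or.inl ((infDist_le_dist_of_mem hy2).trans (by linarith))
      · exact Or.inr ((infDist_le_dist_of_mem hy0).trans (by linarith))
      · exact (hV2 _ (mem_cthickening_of_dist_le _ y _ _ hy1 (by linarith)) hwR).elim
      · exact (hV3 _ (mem_cthickening_of_dist_le _ y _ _ hy3 (by linarith)) hwR).elim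
    · rcases hV1 _ hwR hwD with h | h
      · exact Or.inl ((infDist_le_infDist_add_dist.trans (add_le_add h (by rwa [dist_comm] at hwa))))
      · exact Or.inr ((infDist_le_infDist_add_dist.trans (add_le_add h (by rwa [dist_comm] at hwa))))
  have hq : ∀ a, Good a → triMeshPoint δ a ∈ D.carrier → ∀ q ∈ D.arc 1 ∪ D.arc 3,
      δ < dist q (triMeshPoint δ a) := by
    rintro a ⟨-, w, hw, hwR⟩ - q hq
    by_contra hle
    push Not at hle
    have hwa : dist (triMeshPoint δ w) (triMeshPoint δ a) ≤ δ := siteEndCrossings_dist_anchor_le hδ hw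
    have hwq : dist (triMeshPoint δ w) q ≤ r := by
      rw [dist_comm] at hle; linarith [dist_triangle (triMeshPoint δ w) (triMeshPoint δ a) q]
    rcases hq with hq | hq
    · exact hV2 _ (mem_cthickening_of_dist_le _ q _ _ hq hwq) hwR
    · exact hV3 _ (mem_cthickening_of_dist_le _ q _ _ hq hwq) hwR
  -- the end cells are off `D`, near `D.arc 2`, resp. `D.arc 0`
  have hoff : ∀ {x w : Site 2} (E : Set ℂ), (E = R.arc 0 ∨ E = R.arc 2) →
      ((w 0 = x 0 ∧ w 1 = x 1) ∨ (w 0 = x 0 + 1 ∧ w 1 = x 1) ∨ (w 0 = x 0 ∧ w 1 = x 1 + 1)) →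
      triMeshPoint δ w ∈ R.carrier → infDist (triMeshPoint δ w) E ≤ 2 * δ → triMeshPoint δ x ∉ D.carrier := by
    intro x w E hE hw hwR hwE hxD
    have hwa := siteEndCrossings_dist_anchor_le hδ hw
    obtain ⟨h0, h2⟩ := hV4 _ (mem_cthickening_of_dist_le _ _ _ _ hxD (hwa.trans (by linarith))) hwR
    rcases hE with rfl | rfl <;> linarith
  have hfΩ : triMeshPoint δ xf ∉ D.carrier := hoff (R.arc 0) (Or.inl rfl) hfu hP.1 hu''
  have hlΩ : triMeshPoint δ xl ∉ D.carrier := hoff (R.arc 2) (Or.inr rfl) hlv hP.right_mem hv''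
  have hfA : infDist (triMeshPoint δ xf) (D.arc 2) ≤ t + δ := by
    rcases hclass xf hGf hfΩ with h | h
    · exact h
    · exfalso
      have h1 := siteEndCrossings_le_infDist_add hA0 hD0 hd0 (triMeshPoint δ u') (triMeshPoint δ xf)
      have h2 := siteEndCrossings_dist_anchor_le hδ hfu
      linarith
  have hlB : infDist (triMeshPoint δ xl) (D.arc 0) ≤ t + δ := by
    rcases hclass xl (siteEndCrossings_last_of_chain hch hGf) hlΩ with h | h
    · exfalso
      have h1 := siteEndCrossings_le_infDist_add hD2 hA2 hd2 (triMeshPoint δ xl) (triMeshPoint δ v')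
      have h2 := siteEndCrossings_dist_anchor_le hδ hlv
      rw [dist_comm] at h2
      linarith
    · exact h
  obtain ⟨p, q, hGp, hpD, hpA, hrun, hqD, hqB⟩ := siteEndCrossings_port (Ω := D.carrier) (A := D.arc 2)
    (B := D.arc 0) (C := D.arc 1 ∪ D.arc 3) D.carrier_ne_univ (siteEndCrossings_frontier_subset D).2
    hD2 hD0 hδ hd (by linarith) (Rel := Rel) (Good := Good)
    (fun a b hab => by
      rcases hab with rfl | hab
      · rw [dist_self]; exact hδ.le
      · rw [dist_triMeshPoint_of_triGraph_adj hab, abs_of_pos hδ])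
    hclass hq hGf hch hfΩ hfA hlΩ hlB
  -- the run is an open `𝕋`-path of `σ` inside `D`
  have hpath : ∀ w, Relation.ReflTransGen (fun a b => Rel a b ∧ Good b ∧ triMeshPoint δ b ∈ D.carrier) p w →
      PathIn triGraph (triMeshVertices D.carrier δ ∩ σ) p w := by
    intro w h
    induction h with
    | refl => exact PathIn.refl ⟨hpD, hGp.1⟩
    | tail _ hbc ih =>
      rcases hbc.1 with rfl | hadj
      · exact ih
      · exact ih.tail hadj ⟨hbc.2.2, hbc.2.1.1⟩
  exact ⟨q, p, hqB.trans (by linarith), hpA.trans (by linarith), mem_siteConnIn_iff_pathIn.2 (hpath q hrun).symm⟩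

end Summit.CriticalPhenomena.CardyFormulaZ2.Cruxes.LoopLimitZ2EqT.HexSegment

end
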